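import Mathlib
import Summits.ValiantsHypothesis.ValiantsHypothesis.Theorems.LiouvilleSarnakLiouvilleCutRankHammingBall
import Summits.ValiantsHypothesis.ValiantsHypothesis.Theorems.LiouvilleSarnakLiouvilleCutRankBoundedChanges

/-!
# Route LiouvilleSarnak — crux `LiouvilleCutRank` (stmt-ValiantsHypothesis-14775):
# bounded number of letter changes UP TO `d` DEFECTS

`…BoundedChanges.le_rank_of_changes_le` (≤ `K` letter changes ⟹ rank `≥ W` eventually) combined with the
Hamming-ball closure `…HammingBall.eventually_le_rank_of_near`: every cut at distance `≤ d` (number of row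
positions to move) from a cut with `≤ K` letter changes has rank `≥ W`, for `n ≥ n₀(K, d, W)`.

Honest framing: corollary; `LiouvilleCutRank`, `DigitalBilinearLiouville`, `AlgebraicSarnak` stay OPEN; nothing
bears on `VP ≠ VNP`.  No definitions.
-/

set_option linter.dupNamespace false

noncomputable section

namespace Summit.ValiantsHypothesis.ValiantsHypothesis.Theorems.LiouvilleSarnakLiouvilleCutRank.BoundedChanges

open ArithmeticFunction Finset

open Summit.ValiantsHypothesis.ValiantsHypothesis.Theorems.LiouvilleSarnakLiouvilleCutRank.HammingBall
  (eventually_le_rank_of_near)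

/-- ★ **`≤ K` letter changes up to `d` defects.**  For all `K, d, W` there is `n₀` such that for every
`n ≥ n₀` and all cuts `π, π'` of the `2n` positions: if the word of `π'` has at most `K` letter changes and at
most `d` row positions of `π` are column positions of `π'`, then `rank M_π ≥ W`. [this file] -/
theorem le_rank_of_near_changes_le (K d W : ℕ) : ∃ n₀ : ℕ, ∀ n : ℕ, n₀ ≤ n →
    ∀ (π π' : Fin n ⊕ Fin n ≃ Fin (2 * n)) (w' : ℕ → Bool),
      (∀ j : Fin (2 * n), w' j = (π'.symm j).isLeft) →
      ((range (2 * n - 1)).filter fun k => w' k ≠ w' (k + 1)).card ≤ K →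
      ((univ.image fun i : Fin n => π (Sum.inl i)) \ (univ.image fun i : Fin n => π' (Sum.inl i))).card ≤ d →
      W ≤ (Matrix.of fun r c : Fin n → Bool =>
        (((liouville (Nat.ofBits (fun k : Fin (2 * n) => Sum.elim r c (π.symm k)) + 1) : ℤ) :
          ℂ))).rank := by
  obtain ⟨n₀, hn₀⟩ := eventually_le_rank_of_near
    (fun n π' => ∃ w' : ℕ → Bool, (∀ j : Fin (2 * n), w' j = (π'.symm j).isLeft) ∧
      ((range (2 * n - 1)).filter fun k => w' k ≠ w' (k + 1)).card ≤ K)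
    (fun W' => by
      obtain ⟨n₁, hn₁⟩ := le_rank_of_changes_le K W'
      exact ⟨n₁, fun n hn π' ⟨w', hw', hK⟩ => hn₁ n hn π' w' hw' hK⟩) d W
  exact ⟨n₀, fun n hn π π' w' hw' hK hd => hn₀ n hn π π' ⟨w', hw', hK⟩ hd⟩

end Summit.ValiantsHypothesis.ValiantsHypothesis.Theorems.LiouvilleSarnakLiouvilleCutRank.BoundedChanges

end
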